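import Summits.RiemannHypothesis.RiemannHypothesis.Theorems.HandoffDominationStatus
import Summits.RiemannHypothesis.RiemannHypothesis.Theorems.HandoffProlateDomination
import HarnessLib

/-!
# Window domination laws, III: the prolate domination conjecture in the tree's vocabulary

TRACK «HANDOFF», seat handoff-theory-1 (H-T, statement owner), file XXI-c, companion of
`HandoffDominationStatus.lean` (XXI-a: for every comparison functional `Φ ≥ 0`, a window domination
law `DOM(Φ, λ₀)` is EXACTLY `RH ∧` its zero-side form, `windowDomination_iff`).  Sorry-free, standard
axioms, no definitions, no analysis: one instantiation.

The idea-1 lens's conjecture (PL) «PROLATE DOMINATION» (HOME/handoff/IDEAS-prolate.md §100) is in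
the tree as `Prolate.ProlateDominationWith κ A λ₀` / `Prolate.ProlateDomination` (file
`HandoffProlateDomination.lean`, idea-1 g22's text landed by prove-1 g14): it compares `Re Q(g)` with
`κ·λ^{-A}·L_λ(g)`, `L_λ(g) = Prolate.prolateLeakage λ g = sInf (leakage λ '' fibre λ g)` the least
Slepian leakage `∫_{|ξ| ≥ λ} ‖𝓕 f(ξ)‖² dξ` (prove-1's `LatticeUncertainty.leakage`) over the smooth
even `ℰ`-preimages `f` of `g` time-limited to `[-λ, λ]`.  This file states the placement first for an
ARBITRARY fibre assignment `fib : ℝ → (ℝ → ℂ) → Set (ℝ → ℂ)` and then literally for (PL):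

* `leakage_image_sInf_nonneg` — `0 ≤ sInf (leakage λ '' S)` for every set `S` of functions (the
  leakage is an integral of squares; `Real.sInf_nonneg`, empty fibres included);
* ★ `leakageDomination_iff` — for `κ ≥ 0`, `λ₀ ≥ 0` and ANY fibre assignment,
  `(∀ λ ≥ λ₀, ∀ g ∈ C(log λ), κ·λ^{-A}·sInf (leakage λ '' fib λ g) ≤ Re Q(g))
     ↔ RH ∧ (∀ λ ≥ λ₀, ∀ g ∈ C(log λ), ∀ ε > 0, ∃ T, κ·λ^{-A}·sInf (leakage λ '' fib λ g) ≤ S_T(g) + ε)`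
  with `S_T(g) = Σᶠ_{ρ ∈ weilZeroIndex T} m(ρ)‖ĝ(ρ)‖²` the truncated zero-side energy (zeros of `ζ`
  wherever they lie); `riemannHypothesis_of_leakageDomination` / `leakageDomination_zeroSide` — the
  two RH-free arrows separately ((PL) ⟹ RH never touches the leakage; (PL) ⟹ (PL_Z) is `Re Q ≤ Z`);
* ★★ `prolateDominationWith_iff` — **`Prolate.ProlateDominationWith κ A λ₀ ↔ RH ∧ (PL_Z)(κ, A, λ₀)`**
  for `κ ≥ 0`, `λ₀ ≥ 0` (the instance `fib = Prolate.fibre`; `Iff.rfl` up to unfolding), and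
  `prolateDomination_iff` — **`Prolate.ProlateDomination ↔ RH ∧ ∃ κ > 0, A ≥ 0, λ₀ ≥ 1, (PL_Z)(κ, A, λ₀)`**:
  THE PLACEMENT OF (PL) IN THE KERNEL, on the tree's own statement of the conjecture.

Reading (LOGIC-CARD item 4⁗″, HANDOFF-STATEMENT §J.34–§J.36): (PL_Z) — «the zero-side energy of a
window test dominates the prolate leakage of its preimages» — is RH-free and is (PL)'s entire content
beyond RH; the cell's `κ*` sections bound it from below, the dodger test F4 would attack it.  CAVEAT
(referee r47 HS-45): `Prolate.prolateLeakage λ g` is a real `sInf`, so on an EMPTY fibre it is the junk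
value `0` and both (PL) and (PL_Z) say nothing beyond `0 ≤ Re Q(g)` resp. `0 ≤ Z(g)` for that `g`; the
content of (PL) on every Weil test rests on idea-1's peeling lemma `fibre_nonempty` (prove-1's staged
`HandoffProlatePeeling`), which is NOT used here — the equivalences below hold for the definitions as
they stand, empty fibres included.  Nothing here bears on the truth of RH.
-/

noncomputable section

set_option linter.dupNamespace false  -- the mandated namespace repeats `RiemannHypothesis`

open Set Literature.NumberTheory.LFunctions

namespace Summit.RiemannHypothesis.RiemannHypothesis.Theorems.HandoffDomination

open Summit.RiemannHypothesis.RiemannHypothesis.Theorems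
open Summit.RiemannHypothesis.RiemannHypothesis.Theorems.LatticeUncertainty (leakage)
open Summit.RiemannHypothesis.RiemannHypothesis.Theorems.Prolate (prolateLeakage prolateLeakage_nonneg
  ProlateDominationWith ProlateDomination)

/-- The least leakage over ANY set of candidate preimages is `≥ 0` (empty set: junk value `0`). -/
theorem leakage_image_sInf_nonneg (lam : ℝ) (S : Set (ℝ → ℂ)) :
    0 ≤ sInf (leakage lam '' S) := by
  refine Real.sInf_nonneg ?_
  rintro x ⟨f, -, rfl⟩
  exact Prolate.leakage_nonneg lam f

/-- The prolate comparison functional `κ·λ^{-A}·inf leakage` is `≥ 0` on the windows `λ ≥ λ₀ ≥ 0`. -/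
theorem leakageFunctional_nonneg {κ A lam₀ : ℝ} (hκ : 0 ≤ κ) (h0 : 0 ≤ lam₀)
    (fib : ℝ → (ℝ → ℂ) → Set (ℝ → ℂ)) {lam : ℝ} (hlam : lam₀ ≤ lam) (g : ℝ → ℂ) :
    0 ≤ κ * lam ^ (-A) * sInf (leakage lam '' fib lam g) :=
  mul_nonneg (mul_nonneg hκ (Real.rpow_nonneg (h0.trans hlam) _)) (leakage_image_sInf_nonneg lam _)

/-- **(PL) ⟹ RH never touches the leakage**: a prolate domination law with `κ ≥ 0`, `λ₀ ≥ 0` and any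
fibre assignment implies RH through `Φ ≥ 0` alone (XXI-a `riemannHypothesis_of_windowDomination`;
idea-1 g22's `riemannHypothesis_of_prolateDominationWith` is the instance `fib = Prolate.fibre`). -/
theorem riemannHypothesis_of_leakageDomination {κ A lam₀ : ℝ} (hκ : 0 ≤ κ) (h0 : 0 ≤ lam₀)
    (fib : ℝ → (ℝ → ℂ) → Set (ℝ → ℂ))
    (h : ∀ lam : ℝ, lam₀ ≤ lam → ∀ g : ℝ → ℂ, IsWeilTest g →
      tsupport g ⊆ Icc (-Real.log lam) (Real.log lam) →
        κ * lam ^ (-A) * sInf (leakage lam '' fib lam g) ≤ (weilQuadratic g).re) :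
    _root_.RiemannHypothesis :=
  riemannHypothesis_of_windowDomination
    (Φ := fun lam g ↦ κ * lam ^ (-A) * sInf (leakage lam '' fib lam g))
    (fun _ hlam g _ _ ↦ leakageFunctional_nonneg hκ h0 fib hlam g) h

/-- **(PL) ⟹ (PL_Z), RH-free**: whatever the leakage functional is dominated by Weil's form, it is
dominated by the zero-side energy (XXI-a §1, `Re Q ≤ Z` by the explicit formula's Bessel bound). -/
theorem leakageDomination_zeroSide {κ A lam₀ : ℝ} (fib : ℝ → (ℝ → ℂ) → Set (ℝ → ℂ))
    (h : ∀ lam : ℝ, lam₀ ≤ lam → ∀ g : ℝ → ℂ, IsWeilTest g →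
      tsupport g ⊆ Icc (-Real.log lam) (Real.log lam) →
        κ * lam ^ (-A) * sInf (leakage lam '' fib lam g) ≤ (weilQuadratic g).re) :
    ∀ lam : ℝ, lam₀ ≤ lam → ∀ g : ℝ → ℂ, IsWeilTest g →
      tsupport g ⊆ Icc (-Real.log lam) (Real.log lam) → ∀ ε : ℝ, 0 < ε → ∃ T : ℝ,
        κ * lam ^ (-A) * sInf (leakage lam '' fib lam g) ≤
          (∑ᶠ ρ ∈ weilZeroIndex T, (riemannZetaZeroOrder ρ : ℝ) * ‖weilMellin g ρ‖ ^ 2) + ε :=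
  zeroSideDomination_of_windowDomination
    (Φ := fun lam g ↦ κ * lam ^ (-A) * sInf (leakage lam '' fib lam g)) h

/-- ★ **(PL) ⟺ RH ∧ (PL_Z) in the tree's vocabulary.**  For `κ ≥ 0`, `λ₀ ≥ 0` and ANY fibre
assignment `fib`, the prolate-type domination law «`κ·λ^{-A}·inf_{f ∈ fib λ g} leakage λ f ≤ Re Q(g)` for
every Weil test `g` on `[-log λ, log λ]`, `λ ≥ λ₀`» holds iff RH holds AND the same functional is
dominated by the zero-side energy `sup_T S_T(g)` (zeros wherever they lie).  With idea-1 g22's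
`fib = Prolate.fibre` the left side is `ProlateDominationWith κ A λ₀` verbatim (`prolateLeakage λ g =
sInf (leakage λ '' fibre λ g)`, their `leakage` = the tree's `LatticeUncertainty.leakage` letter for
letter).  [this track (theory-1 gen19), HANDOFF-STATEMENT §J.34; idea-1 IDEAS-prolate §100] -/
theorem leakageDomination_iff {κ A lam₀ : ℝ} (hκ : 0 ≤ κ) (h0 : 0 ≤ lam₀)
    (fib : ℝ → (ℝ → ℂ) → Set (ℝ → ℂ)) :
    (∀ lam : ℝ, lam₀ ≤ lam → ∀ g : ℝ → ℂ, IsWeilTest g →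
        tsupport g ⊆ Icc (-Real.log lam) (Real.log lam) →
          κ * lam ^ (-A) * sInf (leakage lam '' fib lam g) ≤ (weilQuadratic g).re) ↔
      _root_.RiemannHypothesis ∧
        ∀ lam : ℝ, lam₀ ≤ lam → ∀ g : ℝ → ℂ, IsWeilTest g →
          tsupport g ⊆ Icc (-Real.log lam) (Real.log lam) → ∀ ε : ℝ, 0 < ε → ∃ T : ℝ,
            κ * lam ^ (-A) * sInf (leakage lam '' fib lam g) ≤
              (∑ᶠ ρ ∈ weilZeroIndex T, (riemannZetaZeroOrder ρ : ℝ) * ‖weilMellin g ρ‖ ^ 2) + ε :=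
  windowDomination_iff (Φ := fun lam g ↦ κ * lam ^ (-A) * sInf (leakage lam '' fib lam g))
    fun _ hlam g _ _ ↦ leakageFunctional_nonneg hκ h0 fib hlam g

/-! ## The literal placement of (PL) -/

/-- The prolate comparison functional of (PL), `κ·λ^{-A}·L_λ(g)`, is `≥ 0` on the windows `λ ≥ λ₀ ≥ 0`. -/
theorem prolateFunctional_nonneg {κ A lam₀ : ℝ} (hκ : 0 ≤ κ) (h0 : 0 ≤ lam₀) {lam : ℝ}
    (hlam : lam₀ ≤ lam) (g : ℝ → ℂ) : 0 ≤ κ * lam ^ (-A) * prolateLeakage lam g :=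
  mul_nonneg (mul_nonneg hκ (Real.rpow_nonneg (h0.trans hlam) _)) (prolateLeakage_nonneg lam g)

/-- ★★ **(PL) WITH CONSTANTS ⟺ RH ∧ (PL_Z) WITH THE SAME CONSTANTS.**  For `κ ≥ 0`, `λ₀ ≥ 0`:
`Prolate.ProlateDominationWith κ A λ₀` — idea-1's prolate domination law as it stands in the tree —
holds iff the Riemann hypothesis holds AND the zero-side energy of every Weil test `g` on
`[-log λ, log λ]`, `λ ≥ λ₀`, dominates `κ·λ^{-A}·L_λ(g)`:
`∀ ε > 0, ∃ T, κ·λ^{-A}·L_λ(g) ≤ Σ_{|Im ρ| ≤ T} m(ρ)‖ĝ(ρ)‖² + ε` (zeros wherever they lie).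
(Where `Prolate.fibre λ g` is empty, `L_λ(g)` is the junk value `0` and both sides reduce to their
`Φ = 0` instances — referee r47 HS-45; idea-1's `fibre_nonempty` removes the case when it lands.)
[this track (theory-1 gen19), HANDOFF-STATEMENT §J.34–§J.36; idea-1 IDEAS-prolate §100] -/
theorem prolateDominationWith_iff {κ A lam₀ : ℝ} (hκ : 0 ≤ κ) (h0 : 0 ≤ lam₀) :
    ProlateDominationWith κ A lam₀ ↔
      _root_.RiemannHypothesis ∧
        ∀ lam : ℝ, lam₀ ≤ lam → ∀ g : ℝ → ℂ, IsWeilTest g →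
          tsupport g ⊆ Icc (-Real.log lam) (Real.log lam) → ∀ ε : ℝ, 0 < ε → ∃ T : ℝ,
            κ * lam ^ (-A) * prolateLeakage lam g ≤
              (∑ᶠ ρ ∈ weilZeroIndex T, (riemannZetaZeroOrder ρ : ℝ) * ‖weilMellin g ρ‖ ^ 2) + ε := by
  unfold ProlateDominationWith
  exact windowDomination_iff (Φ := fun lam g ↦ κ * lam ^ (-A) * prolateLeakage lam g)
    fun _ hlam g _ _ ↦ prolateFunctional_nonneg hκ h0 hlam g

/-- ★★ **(PL) ⟺ RH ∧ (PL_Z).**  `Prolate.ProlateDomination` (∃ κ > 0, A ≥ 0, λ₀ ≥ 1 with the law) holds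
iff RH holds and, for some such constants, the zero-side energy dominates the prolate leakage on every
window `λ ≥ λ₀`.  The second conjunct is RH-free and is (PL)'s entire content beyond RH; the cell's `κ*`
sections bound it from below and the dodger test F4 would attack it (LOGIC-CARD item 4⁗″). -/
theorem prolateDomination_iff :
    ProlateDomination ↔
      _root_.RiemannHypothesis ∧
        ∃ κ A lam₀ : ℝ, 0 < κ ∧ 0 ≤ A ∧ 1 ≤ lam₀ ∧
          ∀ lam : ℝ, lam₀ ≤ lam → ∀ g : ℝ → ℂ, IsWeilTest g →
            tsupport g ⊆ Icc (-Real.log lam) (Real.log lam) → ∀ ε : ℝ, 0 < ε → ∃ T : ℝ,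
              κ * lam ^ (-A) * prolateLeakage lam g ≤
                (∑ᶠ ρ ∈ weilZeroIndex T, (riemannZetaZeroOrder ρ : ℝ) * ‖weilMellin g ρ‖ ^ 2) + ε := by
  constructor
  · rintro ⟨κ, A, lam₀, hκ, hA, h1, h⟩
    obtain ⟨hRH, hZ⟩ := (prolateDominationWith_iff hκ.le (zero_le_one.trans h1)).1 h
    exact ⟨hRH, κ, A, lam₀, hκ, hA, h1, hZ⟩
  · rintro ⟨hRH, κ, A, lam₀, hκ, hA, h1, hZ⟩
    exact ⟨κ, A, lam₀, hκ, hA, h1, (prolateDominationWith_iff hκ.le (zero_le_one.trans h1)).2 ⟨hRH, hZ⟩⟩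

/-- Hence, RH-free: **(PL) ⟹ (PL_Z)** on the tree's statement — whatever (PL) asserts about Weil's form
it asserts about the zero-side energy. -/
theorem prolateDominationWith_zeroSide {κ A lam₀ : ℝ} (h : ProlateDominationWith κ A lam₀) :
    ∀ lam : ℝ, lam₀ ≤ lam → ∀ g : ℝ → ℂ, IsWeilTest g →
      tsupport g ⊆ Icc (-Real.log lam) (Real.log lam) → ∀ ε : ℝ, 0 < ε → ∃ T : ℝ,
        κ * lam ^ (-A) * prolateLeakage lam g ≤
          (∑ᶠ ρ ∈ weilZeroIndex T, (riemannZetaZeroOrder ρ : ℝ) * ‖weilMellin g ρ‖ ^ 2) + ε :=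
  zeroSideDomination_of_windowDomination (Φ := fun lam g ↦ κ * lam ^ (-A) * prolateLeakage lam g) h

/-- And under RH the converse: **RH ∧ (PL_Z) ⟹ (PL)** on the tree's statement (no sign condition on
the constants is needed in this direction). -/
theorem prolateDominationWith_of_riemannHypothesis {κ A lam₀ : ℝ} (hRH : _root_.RiemannHypothesis)
    (hZ : ∀ lam : ℝ, lam₀ ≤ lam → ∀ g : ℝ → ℂ, IsWeilTest g →
      tsupport g ⊆ Icc (-Real.log lam) (Real.log lam) → ∀ ε : ℝ, 0 < ε → ∃ T : ℝ,
        κ * lam ^ (-A) * prolateLeakage lam g ≤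
          (∑ᶠ ρ ∈ weilZeroIndex T, (riemannZetaZeroOrder ρ : ℝ) * ‖weilMellin g ρ‖ ^ 2) + ε) :
    ProlateDominationWith κ A lam₀ :=
  windowDomination_of_riemannHypothesis
    (Φ := fun lam g ↦ κ * lam ^ (-A) * prolateLeakage lam g) hRH hZ

end Summit.RiemannHypothesis.RiemannHypothesis.Theorems.HandoffDomination

end
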